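import Mathlib
import Summits.RiemannHypothesis.RiemannHypothesis.Theorems.SignConeConeMagnificationDesignStepOne
import Summits.RiemannHypothesis.RiemannHypothesis.Theorems.SignConeConeMagnificationDesignFejer

/-!
# Crux `SignCone.ConeMagnification` (stmt-RiemannHypothesis-16303), line `Sketch` r8, stub `stub_designOfTypes`:
# class facts for the surviving integers of a killer/excluder design

Seat-0 programme for the open core `stub_designOfTypes` (design algebra §3, bookkeeping for Step 2,
`SignConeConeMagnificationDesignDeficitStep`): primes of `D` are their own class and survive; a surviving integer of
class size one outside `D` carries no von Mangoldt mass; the profile factor `Π_{p∈A} √p/2` is bounded on `A ⊆ D`; and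
the Fejér-weighted sum of the rotated class profiles is `−(N/2)·P` on classes of size one and `0` on sizes
`2 ≤ k ≤ N − 2` (`fejer_class_sum`).
-/

noncomputable section

-- `Summit.RiemannHypothesis.RiemannHypothesis.…` repeats a namespace component by design (D-0017 layout).
set_option linter.dupNamespace false

open Finset Filter Complex
open scoped BigOperators ComplexConjugate Topology Real

namespace Summit.RiemannHypothesis.RiemannHypothesis.Theorems.SignConeConeMagnification

namespace Design

/-! ### Class facts for the surviving integers -/

/-- A prime `p ∈ D ⊆ Q` is touched by `Q`, survives the killer/excluder design, and is its own class. [folklore] -/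
theorem prime_class_facts {Q D : Finset ℕ} (hQ : ∀ q ∈ Q, q.Prime) (hDQ : D ⊆ Q) {p : ℕ} (hp : p ∈ D) :
    (∃ q ∈ Q, q ∣ p) ∧ ((∀ q ∈ Q \ D, ¬ q ∣ p) ∧ (∀ p' ∈ D, ¬ p' ^ 2 ∣ p)) ∧ D.filter (· ∣ p) = {p} := by
  have hpP : p.Prime := hQ p (hDQ hp)
  refine ⟨⟨p, hDQ hp, dvd_rfl⟩, ⟨fun q hq hqp => ?_, fun p' hp' h => ?_⟩, ?_⟩
  · have hqP : q.Prime := hQ q (Finset.mem_sdiff.1 hq).1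
    have := (Nat.prime_dvd_prime_iff_eq hqP hpP).1 hqp
    exact (Finset.mem_sdiff.1 hq).2 (this ▸ hp)
  · have hp'P : (p').Prime := hQ p' (hDQ hp')
    have h1 : p' ∣ p := dvd_trans (dvd_pow_self p' two_ne_zero) h
    have := (Nat.prime_dvd_prime_iff_eq hp'P hpP).1 h1
    subst this
    have := Nat.le_of_dvd hpP.pos h
    have := hpP.two_le
    nlinarith
  · ext q
    simp only [Finset.mem_filter, Finset.mem_singleton]
    constructor
    · rintro ⟨hq, hqp⟩
      exact (Nat.prime_dvd_prime_iff_eq (hQ q (hDQ hq)) hpP).1 hqp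
    · rintro rfl
      exact ⟨hp, dvd_rfl⟩

/-- A surviving integer of class size one which is not itself a prime of `D` carries no von Mangoldt mass. [folklore] -/
theorem vonMangoldt_eq_zero_of_class_one {Q D : Finset ℕ} (hQ : ∀ q ∈ Q, q.Prime) (hDQ : D ⊆ Q) {n : ℕ}
    (hsurv : (∀ q ∈ Q \ D, ¬ q ∣ n) ∧ (∀ p ∈ D, ¬ p ^ 2 ∣ n)) (hk : (D.filter (· ∣ n)).card = 1)
    (hnD : n ∉ D) : ArithmeticFunction.vonMangoldt n = 0 := by
  rw [ArithmeticFunction.vonMangoldt_eq_zero_iff]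
  rintro ⟨r, e, hr, he, rfl⟩
  have hr' : r.Prime := Nat.prime_iff.2 hr
  obtain ⟨p, hp⟩ := Finset.card_eq_one.1 hk
  have hpA : p ∈ D.filter (· ∣ r ^ e) := by rw [hp]; exact Finset.mem_singleton_self p
  rw [Finset.mem_filter] at hpA
  have hpP : p.Prime := hQ p (hDQ hpA.1)
  have hpr : p = r := (Nat.prime_dvd_prime_iff_eq hpP hr').1 (hpP.dvd_of_dvd_pow hpA.2)
  subst hpr
  -- `p² ∤ p^e` forces `e = 1`, so `n = p ∈ D`
  have he1 : e = 1 := by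
    by_contra hne
    exact hsurv.2 p hpA.1 (pow_dvd_pow p (by omega : 2 ≤ e))
  subst he1
  exact hnD (by simpa using hpA.1)

/-- Bound for the profile factor `Π_{p∈A} √p/2 ≤ Π_{p∈D} (1 + √p/2)` for `A ⊆ D`. [folklore] -/
theorem prod_sqrt_half_le {D A : Finset ℕ} (hA : A ⊆ D) :
    ∏ p ∈ A, Real.sqrt p / 2 ≤ ∏ p ∈ D, (1 + Real.sqrt p / 2) := by
  calc ∏ p ∈ A, Real.sqrt p / 2 ≤ ∏ p ∈ A, (1 + Real.sqrt p / 2) :=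
        Finset.prod_le_prod (fun i _ => by positivity) (fun i _ => by linarith [Real.sqrt_nonneg (i : ℝ)])
    _ ≤ ∏ p ∈ D, (1 + Real.sqrt p / 2) :=
        Finset.prod_le_prod_of_subset_of_one_le hA (fun i _ => by positivity)
          (fun i _ _ => by linarith [Real.sqrt_nonneg (i : ℝ)])

/-- The Fejér-weighted sum of the rotated class profiles: `−(N/2)·P` on classes of size one, `0` on sizes
`2 ≤ k ≤ N − 2`. [folklore] -/
theorem fejer_class_sum (N k : ℕ) (hk1 : 1 ≤ k) (hkN : k + 2 ≤ N) (Pn : ℝ) :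
    ∑ j ∈ Finset.range N, (1 + Real.cos (2 * π * j / N)) *
        (Pn * ((-1) ^ k * Real.cos (k * (2 * π * j / N)))) =
      if k = 1 then -((N : ℝ) / 2) * Pn else 0 := by
  have hcos : ∀ j : ℕ, Real.cos (k * (2 * π * j / N)) = Real.cos (2 * π * k * j / N) := fun j => by
    congr 1; ring
  simp_rw [hcos]
  have hfac : ∀ j : ℕ, (1 + Real.cos (2 * π * j / N)) * (Pn * ((-1) ^ k * Real.cos (2 * π * k * j / N))) =
      Pn * (-1) ^ k * ((1 + Real.cos (2 * π * j / N)) * Real.cos (2 * π * k * j / N)) := fun j => by ring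
  simp_rw [hfac]
  rw [← Finset.mul_sum]
  by_cases hk : k = 1
  · subst hk
    rw [if_pos rfl]
    have h := fejerSum_one N (by omega)
    simp only [Nat.cast_one] at h ⊢
    rw [h]
    ring
  · rw [if_neg hk, fejerSum_eq_zero N k (by omega) hkN, mul_zero]

/-- **Registered sub-goal `designClassFacts`** (seat-0 anchor of this file, design algebra §3 of the proof of
`stub_designOfTypes`): the Fejér-weighted sum of the rotated class profiles is `−(N/2)·P` on classes of size one and
vanishes on sizes `2 ≤ k ≤ N − 2`. [folklore] -/
theorem designClassFacts : ∀ N k : ℕ, 1 ≤ k → k + 2 ≤ N → ∀ Pn : ℝ,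
    ∑ j ∈ Finset.range N, (1 + Real.cos (2 * π * j / N)) *
        (Pn * ((-1) ^ k * Real.cos (k * (2 * π * j / N)))) =
      if k = 1 then -((N : ℝ) / 2) * Pn else 0 :=
  fun N k hk1 hkN Pn => fejer_class_sum N k hk1 hkN Pn

end Design

end Summit.RiemannHypothesis.RiemannHypothesis.Theorems.SignConeConeMagnification
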